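import Mathlib
import Summits.NavierStokesRegularity.NavierStokesRegularity.Theses.TrappingWindowRungThree
import HarnessLib

/-!
# `TrappingWindowRungThree.WindowCertificateGlue` (item stmt-NavierStokesRegularity-22795)

The glue of the gen-1 split of the crux `WindowCertificate` (item 22616) of route
`TrappingWindowRungThree` into its children `ExactFlowCertificate` (item 22916, shared with route
`ExactWindowRungThree`) and `ShadowingTransfer` (item 22924): by design the second child IS the
implication «exact-flow certificate ⇒ inclusion trapping certificate», so the glue
`ExactFlowCertificate → ShadowingTransfer → WindowCertificate` is modus ponens (the content of the
split lives entirely in the two children; the critic gate idea-crit-3 recorded exactly this on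
2026-08-27T21:41:13Z). This file closes the glue item so that no seat is ever booked on it.

HONEST FRAMING: a one-line tautology over Tao-type MODEL lattice statements; both children are
hypotheses, nothing about the Navier–Stokes equations is concluded, the route's leaf
`TaoLadderRungThree.Target` (TL-M3) is not the summit Statement, and NS regularity is NOT proved by
anything in this file.
-/

-- the sub-problem namespace repeats the summit name by design (D-0017)
set_option linter.dupNamespace false

namespace Summit.NavierStokesRegularity.NavierStokesRegularity.Theorems

/-- **Item stmt-NavierStokesRegularity-22795 (`TrappingWindowRungThree.WindowCertificateGlue`).**
`ExactFlowCertificate → ShadowingTransfer → WindowCertificate`, where `ShadowingTransfer` unfolds to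
«(the text of `ExactFlowCertificate`) → `WindowCertificate`»: modus ponens. MODEL lattice
statement; nothing about Navier–Stokes is concluded. [folklore] -/
theorem trappingWindowRungThree_windowCertificateGlue_proof :
    Summit.NavierStokesRegularity.NavierStokesRegularity.Theses.TrappingWindowRungThree.WindowCertificateGlue := by
  unfold Summit.NavierStokesRegularity.NavierStokesRegularity.Theses.TrappingWindowRungThree.WindowCertificateGlue
    Summit.NavierStokesRegularity.NavierStokesRegularity.Theses.TrappingWindowRungThree.ShadowingTransfer
    Summit.NavierStokesRegularity.NavierStokesRegularity.Theses.TrappingWindowRungThree.ExactFlowCertificate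
  intro hE hS
  exact hS hE

end Summit.NavierStokesRegularity.NavierStokesRegularity.Theorems
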